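import Summits.QuantumFields.BalabanUV.Beta.FP.TowerEvenReadersChartGenericG
import Summits.QuantumFields.BalabanUV.Beta.NVertexChartGenericObjectsG

/-!
# `BalabanUV.Beta.FP.TowerEvenPeriodicityChartGenericG` — road «FP» σ_T XREAD: the GRADED TWIN of `FP.TowerEvenPeriodicityChartGeneric` under {`tabsComp ↦ tabsCompG`, `WNA ↦ WNAG`, `WNs ↦ WNsG`} (director-ym g23 [DIRYM-G23-INBOX-9]
# ruling (1) «located repair σ_T»; census `S-END-G-CENSUS-g73.md` §6 ∕ FP-87); statements = the original's under the token map, proofs VERBATIM; every chain supplier re-pointed to its `…G` twin;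
# record-level mixed-table letters re-pointed to an2's `NVertexGradedRecordLetters` (`exists_locStencilFM_M2NG(_even)`, `M2NG_even_translate`, `periodCov_M2NG_even`, `tabsCompG_M_apply`) and F-L8-G's
# `compMixG_inr` ∕ `M2NG_even_apply_inr_inl`.  Nothing of Bałaban's asserted (ABSOLUTE RULE); 0 estimates; 0∕4 row-D1 binders; `hlawLG` OPEN by name; NOT (C1), NOT (T-ID), NOT SDF, NOT D1,
# NEVER «G-an2-4 closed», NOT BetaPertH, NOT continuum, NOT Clay.

HONEST DEPENDENCY (page 1, mandatory): continuum YM on T⁴ ⇐ BetaPertH ∧ nine spine estimates (0/9 proved); BetaPertH ⇐ (D1) ∧ (D4) ∧ CAP+tail;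
G-an2-4 gates asym, D1 and NE2/3/4.  HONEST FRAMING (cell contract, verbatim): «discharging `BetaPertH` makes Bałaban's UV stability UNCONDITIONAL —
a real constructive-QFT result; it is NOT the continuum limit and NOT the Clay problem.»  ABSOLUTE RULE (cell charter, verbatim): «No internally-minted
statement may enter as a cited fact. Every hypothesis is either kernel-proved in this package or a verbatim quotation of a PUBLISHED theorem with page
reference. The manuscript(s) under audit are NOT citable for their own disputed steps — they are the thing under adjudication; programme-internal
(2001/route/tribunal) claims are never citable.»  Road «FP» OWNER, b2b-balaban-beta-d1-p3 gen 73 (xread) ∕ gen 74 (filing), 2026-08-31 (σ_T; generator `HOME/b2b-balaban-beta-d1-p3/g73/xread-sigmaT/sigmaT.py`; the row's six σ_T modules imported BY NAME from the tree).  No existing file touched.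
-/

noncomputable section

open scoped BigOperators Matrix

namespace Summit.QuantumFields.BalabanUV.Beta.FP.TowerEvenPeriodicityChartGenericG

/-! ## 11w `TowerQN2RowFamily` §1–§3 at `A` ∕ `WNAG` -/

open Literature.MathematicalPhysics.QuantumFieldTheory
open Literature.MathematicalPhysics.QuantumFieldTheory.Balaban1983to89
open Literature.MathematicalPhysics.QuantumFieldTheory.Balaban1983to89.Beta
open B4TorusKernel.MultiPeriod (translate translate_apply)
open B4Reflection242 (translate_translate)
open B5Prop11Plancherel (fine)
open B6Lemma24Torus (pbox wrap)
open AffineAveraging (Site)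
open ExpKernelCalculus (MKer shiftK)
open OneStepResolventKernel (Fib)
open BalabanStepW2 (M2Of_translate)
open SecondOrderResponse (W2SymOfK_translate)
open Summit.QuantumFields.BalabanUV.Beta.TameKernelCalculus (trK)
open Summit.QuantumFields.BalabanUV.Beta.BorderedHessian (sgnK)
open Summit.QuantumFields.BalabanUV.Beta.AxialDressingRooted (one_le_of_neZero)
open Summit.QuantumFields.BalabanUV.Beta.CompositeOneShotJetsGraded (tabsCompG)
open Summit.QuantumFields.BalabanUV.Beta.CompositeOneShotJetData (Roots Pins WN)
open Summit.QuantumFields.BalabanUV.Beta.GAN24.KernelPeriodisation (quo translate_wrap_quo)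
open Summit.QuantumFields.BalabanUV.Beta.FP.KernelPeriodisationFib (perF)
open Summit.QuantumFields.BalabanUV.Beta.FP.KernelPeriodisationFibLoc (dper)
open Summit.QuantumFields.BalabanUV.Beta.FP.TorusCompositeObjects (towerTorus towerTorus_apply)
open Summit.QuantumFields.BalabanUV.Beta.FP.TowerN1RowsFamily (dper_shiftK_period)
open Summit.QuantumFields.BalabanUV.Beta.NVertexParitiesW (WN_eq_W2SymOfK)
open Summit.QuantumFields.BalabanUV.Beta.NVertexWoundPeriodised (shiftK_AN SN_translate T2N_translate)
open Finset Matrix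
open AffineAveraging (box)
open AveragingContoursRooted (ctr ctrOff)
open AveragingHessianKernels (packVH)
open Summit.QuantumFields.BalabanUV.Beta.BorderedHessian (stepScale)
open Summit.QuantumFields.BalabanUV.Beta.SymAveragingHessianCounts (symLinKerAt symVhKerAt)
open Summit.QuantumFields.BalabanUV.Beta.SymAveragingMixedJetTables (symVh2KerAt)
open Summit.QuantumFields.BalabanUV.Beta.CompositeVertexKernelRec (compVH2Ker)
open Summit.QuantumFields.BalabanUV.Beta.CompositeOneShotJetData (AN)
open Summit.QuantumFields.BalabanUV.Beta.FP.KernelPeriodisationFib (Idx)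
open Summit.QuantumFields.BalabanUV.Beta.FP.TorusGaugeCovariance (tgrad)
open Summit.QuantumFields.BalabanUV.Beta.FP.TorusGaugeCovariancePairing (wrapPt wrapPt_coe)
open Summit.QuantumFields.BalabanUV.Beta.FP.TorusCompositeCovariance (itRoot)
open Summit.QuantumFields.BalabanUV.Beta.FP.TorusCompositeObjectsG (compRowsSym)
open Summit.QuantumFields.BalabanUV.Beta.FP.TorusCompositeCovarianceOneSym (compIns₁Sym)
open Summit.QuantumFields.BalabanUV.Beta.FP.TorusCompositeCovarianceTwoPolarSym (compIns₂₂Sym)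
open Summit.QuantumFields.BalabanUV.Beta.FP.TowerQN2Row (hQN2_of_lock)

open ExpKernelCalculus (MKer Decays shiftK VertexFamily₂)
open Summit.QuantumFields.BalabanUV.Beta.TameKernelCalculus (trK)
open Summit.QuantumFields.BalabanUV.Beta.BorderedHessian (sgnK)
open Summit.QuantumFields.BalabanUV.Beta.NVertexChartGenericObjectsG (WNAG)
open Summit.QuantumFields.BalabanUV.Beta.NVertexEvenChartGenericBorderG (WNAG_translate)
open Summit.QuantumFields.BalabanUV.Beta.FP.TowerEvenReadersChartGenericG.QN2Lock (hQN2_of_lockA)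
open Summit.QuantumFields.BalabanUV.Beta.FP.TowerQN2RowFamily (evenHalf_shiftK)

variable {Lc : ℕ} [NeZero Lc] (R : Roots Lc) (P : Pins) (A : MKer (3 + 1) (Fib 3)) (n : ℕ)
  (hA : ∃ δ C : ℝ, 0 < δ ∧ 0 ≤ C ∧ Decays A C δ) (hAσ : trK A = sgnK A) (hAt : ∀ t : Fin (3 + 1) → ℤ, shiftK (-(((Lc ^ (n + 1 + 1) : ℕ) : ℤ) • t)) A = A)
  (M : Fin (3 + 1) → ℕ)

/-! ## §1 Joint block covariance of the N second-order family; the even half commutes with shifts -/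

include hAt in
/-- [folklore] **`WNAG_translate_eq_shiftK` — THE N SECOND-ORDER FAMILY IS JOINTLY BLOCK-COVARIANT**: `WN R P (n+1) μ (y+t) ν (y′+t) = shiftK (−Lc^(n+2)•t) (WN R P (n+1) μ y ν y′)`
(lit `W2SymOfK_translate` at PART 13 `WN_eq_W2SymOfK` with PART 16 §1's letters). -/
theorem WNAG_translate_eq_shiftK (μ : Fin (3 + 1)) (y : Site (3 + 1)) (ν : Fin (3 + 1)) (y' t : Site (3 + 1)) :
    WNAG R P A (n + 1) μ (y + t) ν (y' + t) = shiftK (-(((Lc ^ (n + 1 + 1) : ℕ) : ℤ) • t)) (WNAG R P A (n + 1) μ y ν y') :=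
  WNAG_translate R P A (n + 1) hAt μ y ν y' t


/-! ## §2 The wound even family is separately `M`-periodic in both labels -/

/-- [folklore] **`woundEven_translate_sndA` — the SECOND label**: winding `y′ + M∘m` is winding `y′` re-indexed (`translate_translate`, `Equiv.addLeft`). -/
theorem woundEven_translate_sndA (μ : Fin (3 + 1)) (y : Site (3 + 1)) (ν : Fin (3 + 1)) (y' m : Site (3 + 1)) :
    (fun x w a b => ∑' e : Site (3 + 1), ((1 / 2 : ℝ) • (WNAG R P A (n + 1) μ y ν (translate M (translate M y' m) e)
        + sgnK (trK (WNAG R P A (n + 1) μ y ν (translate M (translate M y' m) e))))) x w a b)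
      = fun x w a b => ∑' e : Site (3 + 1), ((1 / 2 : ℝ) • (WNAG R P A (n + 1) μ y ν (translate M y' e)
        + sgnK (trK (WNAG R P A (n + 1) μ y ν (translate M y' e))))) x w a b := by
  funext x w a b
  simp only [translate_translate]
  exact (Equiv.addLeft m).tsum_eq (fun e => ((1 / 2 : ℝ) • (WNAG R P A (n + 1) μ y ν (translate M y' e)
    + sgnK (trK (WNAG R P A (n + 1) μ y ν (translate M y' e))))) x w a b)

include hAt in
/-- [folklore] **`woundEven_translate_fstA` — the FIRST label**: shifting `y ↦ y + M∘m` is a joint shift of the pair `(y, y′ + M∘e)` by `M∘m` after re-indexing `e ↦ e − m`, hence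
a simultaneous shift of both lattice arguments by the torus period `T∘m`, `T = towerTorus Lc (fine Lc M) (n+1)` (`WNAG_translate_eq_shiftK`, `evenHalf_shiftK`, `Equiv.subRight`). -/
theorem woundEven_translate_fstA (μ : Fin (3 + 1)) (y : Site (3 + 1)) (ν : Fin (3 + 1)) (y' m : Site (3 + 1)) :
    (fun x w a b => ∑' e : Site (3 + 1), ((1 / 2 : ℝ) • (WNAG R P A (n + 1) μ (translate M y m) ν (translate M y' e)
        + sgnK (trK (WNAG R P A (n + 1) μ (translate M y m) ν (translate M y' e))))) x w a b)
      = shiftK (fun i => (towerTorus Lc (fine Lc M) (n + 1) i : ℤ) * (-m) i)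
          (fun x w a b => ∑' e : Site (3 + 1), ((1 / 2 : ℝ) • (WNAG R P A (n + 1) μ y ν (translate M y' e)
            + sgnK (trK (WNAG R P A (n + 1) μ y ν (translate M y' e))))) x w a b) := by
  -- the joint shift vector
  have hvec : -(((Lc ^ (n + 1 + 1) : ℕ) : ℤ) • (fun i => (M i : ℤ) * m i)) = fun i => (towerTorus Lc (fine Lc M) (n + 1) i : ℤ) * (-m) i := by
    funext i
    simp only [Pi.neg_apply, Pi.smul_apply, smul_eq_mul, towerTorus_apply]
    push_cast
    ring
  have hy : translate M y m = y + (fun i => (M i : ℤ) * m i) := by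
    funext i; simp only [translate_apply, Pi.add_apply]
  have hy' : ∀ e : Site (3 + 1), translate M y' e = translate M y' (e - m) + (fun i => (M i : ℤ) * m i) := fun e => by
    funext i; simp only [translate_apply, Pi.add_apply, Pi.sub_apply]; ring
  funext x w a b
  -- termwise: joint covariance, then the even half through the shift
  have hterm : ∀ e : Site (3 + 1), ((1 / 2 : ℝ) • (WNAG R P A (n + 1) μ (translate M y m) ν (translate M y' e)
        + sgnK (trK (WNAG R P A (n + 1) μ (translate M y m) ν (translate M y' e))))) x w a b
      = shiftK (fun i => (towerTorus Lc (fine Lc M) (n + 1) i : ℤ) * (-m) i)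
          ((1 / 2 : ℝ) • (WNAG R P A (n + 1) μ y ν (translate M y' (e - m)) + sgnK (trK (WNAG R P A (n + 1) μ y ν (translate M y' (e - m)))))) x w a b := by
    intro e
    rw [hy, hy' e, WNAG_translate_eq_shiftK R P A n hAt μ y ν (translate M y' (e - m)), hvec, evenHalf_shiftK]
  simp_rw [hterm]
  exact (Equiv.subRight m).tsum_eq (fun e => shiftK (fun i => (towerTorus Lc (fine Lc M) (n + 1) i : ℤ) * (-m) i)
    ((1 / 2 : ℝ) • (WNAG R P A (n + 1) μ y ν (translate M y' e) + sgnK (trK (WNAG R P A (n + 1) μ y ν (translate M y' e))))) x w a b)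

include hAt in
/-- [folklore] **`perF_dper_woundEven_translate_fstA`** — the torus matrix of the wound even family is `M`-periodic in the FIRST label (`woundEven_translate_fstA` + #5 `dper_shiftK_period`). -/
theorem perF_dper_woundEven_translate_fstA (μ : Fin (3 + 1)) (y : Site (3 + 1)) (ν : Fin (3 + 1)) (y' m : Site (3 + 1)) :
    perF (towerTorus Lc (fine Lc M) (n + 1)) (dper (towerTorus Lc (fine Lc M) (n + 1))
        (fun x w a b => ∑' e : Site (3 + 1), ((1 / 2 : ℝ) • (WNAG R P A (n + 1) μ (translate M y m) ν (translate M y' e)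
          + sgnK (trK (WNAG R P A (n + 1) μ (translate M y m) ν (translate M y' e))))) x w a b))
      = perF (towerTorus Lc (fine Lc M) (n + 1)) (dper (towerTorus Lc (fine Lc M) (n + 1))
        (fun x w a b => ∑' e : Site (3 + 1), ((1 / 2 : ℝ) • (WNAG R P A (n + 1) μ y ν (translate M y' e)
          + sgnK (trK (WNAG R P A (n + 1) μ y ν (translate M y' e))))) x w a b)) := by
  rw [woundEven_translate_fstA R P A n hAt M μ y ν y' m, dper_shiftK_period]

/-- [folklore] **`perF_dper_woundEven_translate_sndA`** — and in the SECOND label (`woundEven_translate_sndA`). -/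
theorem perF_dper_woundEven_translate_sndA (μ : Fin (3 + 1)) (y : Site (3 + 1)) (ν : Fin (3 + 1)) (y' m : Site (3 + 1)) :
    perF (towerTorus Lc (fine Lc M) (n + 1)) (dper (towerTorus Lc (fine Lc M) (n + 1))
        (fun x w a b => ∑' e : Site (3 + 1), ((1 / 2 : ℝ) • (WNAG R P A (n + 1) μ y ν (translate M (translate M y' m) e)
          + sgnK (trK (WNAG R P A (n + 1) μ y ν (translate M (translate M y' m) e))))) x w a b))
      = perF (towerTorus Lc (fine Lc M) (n + 1)) (dper (towerTorus Lc (fine Lc M) (n + 1))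
        (fun x w a b => ∑' e : Site (3 + 1), ((1 / 2 : ℝ) • (WNAG R P A (n + 1) μ y ν (translate M y' e)
          + sgnK (trK (WNAG R P A (n + 1) μ y ν (translate M y' e))))) x w a b)) := by
  rw [woundEven_translate_sndA R P A n M μ y ν y' m]

include hAt in
/-- [folklore] **`perF_dper_woundEven_wrapA` — BOTH LABELS MAY BE READ AT THEIR BOX REPRESENTATIVES**:
`… (wound even at (μ, wrap M y; ν, wrap M y′)) = … (wound even at (μ, y; ν, y′))` (`translate_wrap_quo` twice). -/
theorem perF_dper_woundEven_wrapA [∀ μ, NeZero (M μ)] (μ : Fin (3 + 1)) (y : Site (3 + 1)) (ν : Fin (3 + 1)) (y' : Site (3 + 1)) :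
    perF (towerTorus Lc (fine Lc M) (n + 1)) (dper (towerTorus Lc (fine Lc M) (n + 1))
        (fun x w a b => ∑' e : Site (3 + 1), ((1 / 2 : ℝ) • (WNAG R P A (n + 1) μ (wrap M y : Site (3 + 1)) ν (translate M (wrap M y' : Site (3 + 1)) e)
          + sgnK (trK (WNAG R P A (n + 1) μ (wrap M y : Site (3 + 1)) ν (translate M (wrap M y' : Site (3 + 1)) e))))) x w a b))
      = perF (towerTorus Lc (fine Lc M) (n + 1)) (dper (towerTorus Lc (fine Lc M) (n + 1))
        (fun x w a b => ∑' e : Site (3 + 1), ((1 / 2 : ℝ) • (WNAG R P A (n + 1) μ y ν (translate M y' e)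
          + sgnK (trK (WNAG R P A (n + 1) μ y ν (translate M y' e))))) x w a b)) := by
  conv_rhs => rw [← translate_wrap_quo M y, ← translate_wrap_quo M y']
  rw [perF_dper_woundEven_translate_fstA R P A n hAt M μ (wrap M y : Site (3 + 1)) ν (translate M (wrap M y' : Site (3 + 1)) (quo M y')) (quo M y),
    perF_dper_woundEven_translate_sndA R P A n M μ (wrap M y : Site (3 + 1)) ν (wrap M y' : Site (3 + 1)) (quo M y')]

/-! ## §3 v5's row `hQN₂` FOR EVERY LABEL PAIR `(μ, y; ν, y′)`, `y, y′ : ℤ⁴` (per box), from `TowerQN2Row.hQN2_of_lockA` -/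

section Family

variable (c : ℝ) (Pn : Pins) [∀ μ, NeZero (M μ)]
  -- (H) `TowerQN2RowCopies` §2's letters on the source type `κ := pbox M × Fin 4` (labels `yN a := a.1`, `μN a := a.2`, as #5)
variable (fN : (↥(pbox M) × Fin (3 + 1)) → Idx (towerTorus Lc (fine Lc M) (n + 1)) (Fib 3))
  (hfN : ∀ a : ↥(pbox M) × Fin (3 + 1),
    fN a = (wrapPt (towerTorus Lc (fine Lc M) (n + 1)) (((Lc ^ (n + 1 + 1) : ℕ) : ℤ) • (a.1 : Site (3 + 1))), Sum.inr a.2))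
variable (hc : ctrOff (3 + 1) Lc ∈ box (3 + 1) Lc)
  (hv : ((↥(pbox M) × Fin (3 + 1)) → ℝ) → (↥(pbox (towerTorus Lc (fine Lc M) (n + 1))) × Fin (3 + 1) → ℝ))
  (hhvl : ∀ (r : ℝ) (x y : (↥(pbox M) × Fin (3 + 1)) → ℝ), hv (r • x + y) = r • hv x + hv y)
  (lv : ((↥(pbox M) × Fin (3 + 1)) → ℝ) → ↥(pbox (towerTorus Lc (fine Lc M) (n + 1))) → ℝ)
  (hlv : ∀ (r : ℝ) (x y : (↥(pbox M) × Fin (3 + 1)) → ℝ), lv (r • x + y) = r • lv x + lv y)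
  (hJW : ∀ (a : ↥(pbox M) × Fin (3 + 1)) (b : ↥(pbox (towerTorus Lc (fine Lc M) (n + 1))) × Fin (3 + 1)), hv (Pi.single a 1) b
      = perF (towerTorus Lc (fine Lc M) (n + 1)) A (b.1, Sum.inl b.2)
          (wrapPt (towerTorus Lc (fine Lc M) (n + 1)) (((Lc ^ (n + 1 + 1) : ℕ) : ℤ) • (a.1 : Site (3 + 1))), Sum.inr a.2)
        - ∑ s : ↥(pbox (towerTorus Lc (fine Lc M) (n + 1))), tgrad (towerTorus Lc (fine Lc M) (n + 1)) (b.1, Sum.inl b.2) s * lv (Pi.single a 1) s)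
  (𝔔₀ : Matrix ((↥(pbox M) × Fin (3 + 1))) (↥(pbox (towerTorus Lc (fine Lc M) (n + 1))) × Fin (3 + 1)) ℝ)
  (h𝔔₀' : 𝔔₀ = (compRowsSym Lc M (fun i : ℕ => n + 1 - (i - 1)) (fun _ : ℕ => ctrOff (3 + 1) Lc) (n + 1 + 1) :
      Matrix ((↥(pbox M) × Fin (3 + 1))) (↥(pbox (towerTorus Lc (fine Lc M) (n + 1))) × Fin (3 + 1)) ℝ))
  (𝔔₁f : ((↥(pbox M) × Fin (3 + 1)) → ℝ) → Matrix ((↥(pbox M) × Fin (3 + 1))) (↥(pbox (towerTorus Lc (fine Lc M) (n + 1))) × Fin (3 + 1)) ℝ)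
  (h𝔔₁' : ∀ v, 𝔔₁f v = c • compIns₁Sym Lc M (fun i : ℕ => n + 1 - (i - 1)) (fun _ : ℕ => ctrOff (3 + 1) Lc) (n + 1 + 1) (hv v))
  (𝔔₂f : ((↥(pbox M) × Fin (3 + 1)) → ℝ) → ((↥(pbox M) × Fin (3 + 1)) → ℝ) → Matrix ((↥(pbox M) × Fin (3 + 1))) (↥(pbox (towerTorus Lc (fine Lc M) (n + 1))) × Fin (3 + 1)) ℝ)
  (h𝔔₂' : ∀ v v', (1 / 2 : ℝ) • (𝔔₂f v v' + 𝔔₂f v' v)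
    = c ^ 2 • compIns₂₂Sym Lc M (fun i : ℕ => n + 1 - (i - 1)) (fun _ : ℕ => ctrOff (3 + 1) Lc) (n + 1 + 1) (hv v) (hv v'))
  (Xbf : ((↥(pbox M) × Fin (3 + 1)) → ℝ) → Matrix ((↥(pbox M) × Fin (3 + 1))) ((↥(pbox M) × Fin (3 + 1))) ℝ)
  (hXbf : ∀ v, Xbf v = c • Matrix.diagonal (fun a : (↥(pbox M) × Fin (3 + 1)) =>
    lv v (itRoot Lc M (fun _ : ℕ => ctrOff (3 + 1) Lc) (fun _ => hc) (n + 1 + 1) a.1)))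
  (𝔔'₂f : ((↥(pbox M) × Fin (3 + 1)) → ℝ) → ((↥(pbox M) × Fin (3 + 1)) → ℝ) → Matrix ((↥(pbox M) × Fin (3 + 1))) (↥(pbox (towerTorus Lc (fine Lc M) (n + 1))) × Fin (3 + 1)) ℝ)
  (h𝔔'₂f : ∀ v v', 𝔔'₂f v v' = Xbf v * Xbf v' * 𝔔₀ + (Xbf v * 𝔔₁f v' + Xbf v * 𝔔₀ * (-(c • Matrix.diagonal (fun b : (↥(pbox (towerTorus Lc (fine Lc M) (n + 1))) × Fin (3 + 1)) => lv v' b.1))))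
      + ((Xbf v * 𝔔₁f v' + Xbf v * 𝔔₀ * (-(c • Matrix.diagonal (fun b : (↥(pbox (towerTorus Lc (fine Lc M) (n + 1))) × Fin (3 + 1)) => lv v' b.1)))) + (𝔔₂f v v' + 𝔔₁f v * (-(c • Matrix.diagonal (fun b : (↥(pbox (towerTorus Lc (fine Lc M) (n + 1))) × Fin (3 + 1)) => lv v' b.1))) + (𝔔₁f v * (-(c • Matrix.diagonal (fun b : (↥(pbox (towerTorus Lc (fine Lc M) (n + 1))) × Fin (3 + 1)) => lv v' b.1))) + 𝔔₀ * ((-(c • Matrix.diagonal (fun b : (↥(pbox (towerTorus Lc (fine Lc M) (n + 1))) × Fin (3 + 1)) => lv v b.1))) * (-(c • Matrix.diagonal (fun b : (↥(pbox (towerTorus Lc (fine Lc M) (n + 1))) × Fin (3 + 1)) => lv v' b.1))))))))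
  (r : ℝ)
  -- the direction FAMILY: one top one-shot source per label, scaled by the pin's `r` (as #5)
  (dv : Fin (3 + 1) × Site (3 + 1) → ((↥(pbox M) × Fin (3 + 1)) → ℝ))
  (hdv : ∀ (μ : Fin (3 + 1)) (y : Site (3 + 1)), dv (μ, y) = r • (Pi.single (wrapPt M y, μ) (1 : ℝ) : (↥(pbox M) × Fin (3 + 1)) → ℝ))
  -- THE SECOND-ORDER LOCK ROW on the free pin `Pn.cB (n+2)` (SPEC-54 §5; J-NOTE-11)
  (hcB : c ^ 2 * r * r * ∏ ℓ ∈ range (n + 1 + 1), (stepScale 3 Lc ℓ * ((box (3 + 1) Lc).card : ℝ)) = -(Pn.cB (n + 1 + 1)))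

include hfN hhvl hlv hJW h𝔔₀' h𝔔₁' h𝔔₂' hXbf h𝔔'₂f hdv hcB hA hAσ hAt in
/-- [folklore] **`hQN2_family_of_lockA` — v5's ROW `hQN₂ n μ y ν y′ B` FOR EVERY LABEL PAIR, `y, y′ : ℤ⁴`** (per box `M := Mc B`):
`½•(𝔔′₂f (dv (μ,y)) (dv (ν,y′)) + 𝔔′₂f (dv (ν,y′)) (dv (μ,y))) = (perF T (dper T (x w ↦ Σ'_e WN♮ μ y ν (translate M y′ e) x w))).submatrix fN e_F`
(`TowerQN2Row.hQN2_of_lockA` — an2 PART 20 inside — at the sources `(wrapPt M y, μ)`, `(wrapPt M y′, ν)` + §2 `perF_dper_woundEven_wrapA`); modulo the lock row `hcB` ALONE. -/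
theorem hQN2_family_of_lockA (μ : Fin (3 + 1)) (y : Site (3 + 1)) (ν : Fin (3 + 1)) (y' : Site (3 + 1)) :
    (1 / 2 : ℝ) • (𝔔'₂f (dv (μ, y)) (dv (ν, y')) + 𝔔'₂f (dv (ν, y')) (dv (μ, y)))
      = (perF (towerTorus Lc (fine Lc M) (n + 1)) (dper (towerTorus Lc (fine Lc M) (n + 1))
          (fun X Z i₁ i₂ => ∑' e : Site (3 + 1), ((1 / 2 : ℝ) • (WNAG (Roots.ctr Lc) Pn A (n + 1) μ y ν (translate M y' e)
            + sgnK (trK (WNAG (Roots.ctr Lc) Pn A (n + 1) μ y ν (translate M y' e))))) X Z i₁ i₂))).submatrix fN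
          (fun b : ↥(pbox (towerTorus Lc (fine Lc M) (n + 1))) × Fin (3 + 1) => ((b.1, Sum.inl b.2) : Idx (towerTorus Lc (fine Lc M) (n + 1)) (Fib 3))) := by
  have h := hQN2_of_lockA M n c Pn A hA hAσ hAt fN hfN hc (fun a : ↥(pbox M) × Fin (3 + 1) => (a.1 : Site (3 + 1))) (fun a => a.2) hv hhvl lv hlv hJW
    𝔔₀ h𝔔₀' 𝔔₁f h𝔔₁' 𝔔₂f h𝔔₂' Xbf hXbf 𝔔'₂f h𝔔'₂f r (wrapPt M y, μ) (wrapPt M y', ν) hcB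
  rw [hdv, hdv, h]
  show (perF _ (dper _ (fun X Z i₁ i₂ => ∑' e : Site (3 + 1), ((1 / 2 : ℝ) • (WNAG (Roots.ctr Lc) Pn A (n + 1) μ ((wrapPt M y : ↥(pbox M)) : Site (3 + 1)) ν
      (translate M ((wrapPt M y' : ↥(pbox M)) : Site (3 + 1)) e) + sgnK (trK (WNAG (Roots.ctr Lc) Pn A (n + 1) μ ((wrapPt M y : ↥(pbox M)) : Site (3 + 1)) ν
      (translate M ((wrapPt M y' : ↥(pbox M)) : Site (3 + 1)) e))))) X Z i₁ i₂))).submatrix _ _ = _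
  rw [wrapPt_coe, wrapPt_coe, perF_dper_woundEven_wrapA (Roots.ctr Lc) Pn A n hAt M]

end Family

end Summit.QuantumFields.BalabanUV.Beta.FP.TowerEvenPeriodicityChartGenericG

end
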